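import Summits.HubbardSuperconductivity.HubbardLadder.Bounds.StiffnessFromEnergyBracketsTPrime
import HarnessLib

/-!
# Hubbard ladder — Bounds: the double occupancy and the total kinetic weight of sector ground
# states of the `t–t'–U` torus are monotone in `U` (extremiser fact E7, typed AND proved)

HONEST FRAMING (cell pub-hubbard): ladder R1–R4 with certified numbers; no claim on H/H₀. This is
a statement about a MODEL CLASS (the `t–t'` Hubbard torus `hubbardTorusTT' L 1 t' U` on `(ℤ/L)²`,
every `t'`, `U`, sector), no materials claim. Companion text: `pub-hubbard/paper/bounds.tex`
Prop. 6; table `pub-hubbard/pub-hubbard-bounds/EXTREMISERS.md` §3 E7. NEW (elementary)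
mathematics about which member of the `t–t'–U` family maximises the right-hand side of the f-sum
stiffness ceiling, hence placed under `Summits/…` (LEAN PLACEMENT RULE), importing only the
landed `Bounds/StiffnessFromEnergyBracketsTPrime`.

For the `t–t'` Hubbard torus `H(U) = hubbardTorusTT' L 1 t' U` (`t = 1`, fixed `t'`, `L ≥ 3`) one has
`Re⟨ψ, H(U) ψ⟩ = -2 𝒦(ψ) + U D(ψ)` with the TOTAL kinetic weight
`𝒦(ψ) = K_x(ψ) + K_y(ψ) + t' K_d(ψ)` (`kinWeightDir 0 + kinWeightDir 1 + t' kinWeightDiag`, i.e.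
`𝒦 = ½⟨-T⟩_ψ`) and the double occupancy `D(ψ) = doubleOccExp ψ`. Since `H` is affine in `U`,
two applications of the sector variational principle (the chord inequality
`sectorEnergyTT'_le_add_mul_doubleOccExp`, crossed between two couplings) give, for ANY unit ground
states `ψ₁`, `ψ₂` of `H(U₁)`, `H(U₂)` in the same `(N, S^z)` sector (degenerate ground states
allowed, no differentiability):

* `DoubleOccupancyAntitoneU` (`@[conjecture] def`, PROVED): `U₁ < U₂ ⇒ D(ψ₂) ≤ D(ψ₁)`;
* `KineticWeightAntitoneU` (`@[conjecture] def`, PROVED): `0 ≤ U₁ < U₂ ⇒ 𝒦(ψ₂) ≤ 𝒦(ψ₁)`, and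
  `kinWeightTT'_le_of_nonpos`: `U₁ < U₂ ≤ 0 ⇒ 𝒦(ψ₁) ≤ 𝒦(ψ₂)`;
* `KineticWeightMaximalAtZeroU` (`@[conjecture] def`, PROVED): for every `U` and every unit ground
  state `ψ` of `H(U)` and `ψ₀` of `H(0)` in the same sector, `𝒦(ψ) ≤ 𝒦(ψ₀)`: over the whole
  `U`-axis of the family the total kinetic weight — the isotropic f-sum right-hand side `½⟨-T⟩` —
  is maximised by the free Fermi sea, where the one-body (bathtub) ceiling of `bounds.tex` Thm 2 is
  attained.

What it does NOT say: the DIRECTIONAL weight `K_x + t' K_d` of the `x`-twist ceiling equals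
`½𝒦 + ½ t' K_d` only after the rotation average, and `K_d` alone is not monotone in `U` by this
argument (it is controlled by the chord in `t'`, `sectorEnergyTT'_le_sub_mul_kinWeightDiag`); no
statement at `T > 0` (there the free energy is concave in `U` but `⟨-T⟩_β` picks up an entropy
term); no number, no claim on H/H₀.

References (keys of `lean/references.bib`): KomaTasaki1994 §1 (supergradients of concave ground
energies); LiebPRL1989; ParamekantiTrivediRanderia1998 §III (the kinetic energy decreases with
`U`, stated there for the numerics); HazraVermaRanderia2019 App. G.
-/

noncomputable section

namespace Summit.HubbardSuperconductivity.HubbardLadder.Bounds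

open Matrix Finset Real
open Literature.MathematicalPhysics.QuantumLattice
open Literature.MathematicalPhysics.QuantumFieldTheory
open Literature.Probability.LatticeModels
open Literature.MathematicalPhysics.QuantumLattice.LangerMattis
open scoped ComplexOrder ComplexConjugate

variable {L : ℕ} [NeZero L]

/-! ### Double occupancy is antitone in `U` -/

/-- **Crossed chords**: for unit ground states `ψ₁`, `ψ₂` of `H(U₁)`, `H(U₂)` in one sector,
`(U₂ - U₁) (D(ψ₂) - D(ψ₁)) ≤ 0`. -/
theorem mul_sub_doubleOccExp_nonpos (t' : ℝ) {U₁ U₂ : ℝ} {N : ℕ} {M : ℝ}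
    {ψ₁ ψ₂ : Fock (Orb (FermionTorus 2 L))}
    (hgs₁ : IsGroundStateInSector (hubbardTorusTT' L 1 t' U₁) N M ψ₁) (h1₁ : star ψ₁ ⬝ᵥ ψ₁ = 1)
    (hgs₂ : IsGroundStateInSector (hubbardTorusTT' L 1 t' U₂) N M ψ₂) (h1₂ : star ψ₂ ⬝ᵥ ψ₂ = 1) :
    (U₂ - U₁) * (doubleOccExp ψ₂ - doubleOccExp ψ₁) ≤ 0 := by
  have h12 := sectorEnergyTT'_le_add_mul_doubleOccExp hgs₁ h1₁ U₂
  have h21 := sectorEnergyTT'_le_add_mul_doubleOccExp hgs₂ h1₂ U₁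
  nlinarith [h12, h21]

/-- **Double occupancy is antitone in `U`** (`@[conjecture] def`, PROVED by
`doubleOccupancyAntitoneU_holds`): for `U₁ < U₂` and unit ground states `ψ₁`, `ψ₂` of the `t–t'`
torus at `U₁`, `U₂` in the same `(N, S^z)` sector, `D(ψ₂) ≤ D(ψ₁)`. -/
@[conjecture] def DoubleOccupancyAntitoneU : Prop :=
  ∀ (L : ℕ) [NeZero L] (t' U₁ U₂ : ℝ), U₁ < U₂ → ∀ (N : ℕ) (M : ℝ)
    (ψ₁ ψ₂ : Fock (Orb (FermionTorus 2 L))),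
    IsGroundStateInSector (hubbardTorusTT' L 1 t' U₁) N M ψ₁ → star ψ₁ ⬝ᵥ ψ₁ = 1 →
    IsGroundStateInSector (hubbardTorusTT' L 1 t' U₂) N M ψ₂ → star ψ₂ ⬝ᵥ ψ₂ = 1 →
    doubleOccExp ψ₂ ≤ doubleOccExp ψ₁

/-- **`DoubleOccupancyAntitoneU` holds.** -/
theorem doubleOccupancyAntitoneU_holds : DoubleOccupancyAntitoneU := by
  intro L _ t' U₁ U₂ hU N M ψ₁ ψ₂ hgs₁ h1₁ hgs₂ h1₂
  have h := mul_sub_doubleOccExp_nonpos t' hgs₁ h1₁ hgs₂ h1₂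
  by_contra hlt
  push Not at hlt
  have hpos := mul_pos (sub_pos.2 hU) (sub_pos.2 hlt)
  linarith

/-! ### The total kinetic weight is antitone in `|U|` -/

/-- The total kinetic weight `𝒦(ψ) = K_x(ψ) + K_y(ψ) + t' K_d(ψ)` (`= ½⟨-T⟩_ψ` for the `t–t'` torus,
`t = 1`). -/
def kinWeightTT' (t' : ℝ) (ψ : Fock (Orb (FermionTorus 2 L))) : ℝ :=
  kinWeightDir 0 ψ + kinWeightDir 1 ψ + t' * kinWeightDiag ψ

/-- `-2 𝒦(ψ) + U D(ψ) = E^{tt'}(U; N, M)` for a unit sector ground state `ψ` (`L ≥ 3`). -/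
theorem kinWeightTT'_energy_eq (hL : 3 ≤ L) {t' U : ℝ} {N : ℕ} {M : ℝ}
    {ψ : Fock (Orb (FermionTorus 2 L))} (hgs : IsGroundStateInSector (hubbardTorusTT' L 1 t' U) N M ψ)
    (h1 : star ψ ⬝ᵥ ψ = 1) :
    -(2 * kinWeightTT' t' ψ) + U * doubleOccExp ψ = sectorEnergyTT' L t' U N M := by
  rw [kinWeightTT', ← re_expect_hubbardTorusTT'_eq_kin hL t' U ψ, re_expect_eq_sectorEnergyTT' hgs h1]

/-- **Repulsive side**: `0 ≤ U₁ < U₂ ⇒ 𝒦(ψ₂) ≤ 𝒦(ψ₁)` for unit sector ground states `ψ₁`, `ψ₂` at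
`U₁`, `U₂` (`L ≥ 3`). Proof: the chord from `U₂` to `U₁` reads `-2𝒦₁ + U₁D₁ ≤ -2𝒦₂ + U₁D₂`, and
`D₂ ≤ D₁`, `U₁ ≥ 0`. -/
theorem kinWeightTT'_le_of_nonneg (hL : 3 ≤ L) (t' : ℝ) {U₁ U₂ : ℝ} (hU₁ : 0 ≤ U₁) (hU : U₁ < U₂)
    {N : ℕ} {M : ℝ} {ψ₁ ψ₂ : Fock (Orb (FermionTorus 2 L))}
    (hgs₁ : IsGroundStateInSector (hubbardTorusTT' L 1 t' U₁) N M ψ₁) (h1₁ : star ψ₁ ⬝ᵥ ψ₁ = 1)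
    (hgs₂ : IsGroundStateInSector (hubbardTorusTT' L 1 t' U₂) N M ψ₂) (h1₂ : star ψ₂ ⬝ᵥ ψ₂ = 1) :
    kinWeightTT' t' ψ₂ ≤ kinWeightTT' t' ψ₁ := by
  have hD := doubleOccupancyAntitoneU_holds L t' U₁ U₂ hU N M ψ₁ ψ₂ hgs₁ h1₁ hgs₂ h1₂
  have h21 := sectorEnergyTT'_le_add_mul_doubleOccExp hgs₂ h1₂ U₁
  have e₁ := kinWeightTT'_energy_eq hL hgs₁ h1₁
  have e₂ := kinWeightTT'_energy_eq hL hgs₂ h1₂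
  have hUD := mul_le_mul_of_nonneg_left hD hU₁
  nlinarith [h21, e₁, e₂, hUD]

/-- **Attractive side**: `U₁ < U₂ ≤ 0 ⇒ 𝒦(ψ₁) ≤ 𝒦(ψ₂)` (`L ≥ 3`). -/
theorem kinWeightTT'_le_of_nonpos (hL : 3 ≤ L) (t' : ℝ) {U₁ U₂ : ℝ} (hU₂ : U₂ ≤ 0) (hU : U₁ < U₂)
    {N : ℕ} {M : ℝ} {ψ₁ ψ₂ : Fock (Orb (FermionTorus 2 L))}
    (hgs₁ : IsGroundStateInSector (hubbardTorusTT' L 1 t' U₁) N M ψ₁) (h1₁ : star ψ₁ ⬝ᵥ ψ₁ = 1)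
    (hgs₂ : IsGroundStateInSector (hubbardTorusTT' L 1 t' U₂) N M ψ₂) (h1₂ : star ψ₂ ⬝ᵥ ψ₂ = 1) :
    kinWeightTT' t' ψ₁ ≤ kinWeightTT' t' ψ₂ := by
  have hD := doubleOccupancyAntitoneU_holds L t' U₁ U₂ hU N M ψ₁ ψ₂ hgs₁ h1₁ hgs₂ h1₂
  have h12 := sectorEnergyTT'_le_add_mul_doubleOccExp hgs₁ h1₁ U₂
  have e₁ := kinWeightTT'_energy_eq hL hgs₁ h1₁
  have e₂ := kinWeightTT'_energy_eq hL hgs₂ h1₂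
  have hUD : U₂ * doubleOccExp ψ₁ ≤ U₂ * doubleOccExp ψ₂ := mul_le_mul_of_nonpos_left hD hU₂
  nlinarith [h12, e₁, e₂, hUD]

/-- **Same coupling**: two unit ground states of `H(U)` at `U = 0` in one sector have the same total
kinetic weight (`-2𝒦 = E`). -/
theorem kinWeightTT'_eq_of_zero (hL : 3 ≤ L) (t' : ℝ) {N : ℕ} {M : ℝ}
    {ψ₁ ψ₂ : Fock (Orb (FermionTorus 2 L))}
    (hgs₁ : IsGroundStateInSector (hubbardTorusTT' L 1 t' 0) N M ψ₁) (h1₁ : star ψ₁ ⬝ᵥ ψ₁ = 1)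
    (hgs₂ : IsGroundStateInSector (hubbardTorusTT' L 1 t' 0) N M ψ₂) (h1₂ : star ψ₂ ⬝ᵥ ψ₂ = 1) :
    kinWeightTT' t' ψ₁ = kinWeightTT' t' ψ₂ := by
  have e₁ := kinWeightTT'_energy_eq hL hgs₁ h1₁
  have e₂ := kinWeightTT'_energy_eq hL hgs₂ h1₂
  simp only [zero_mul, add_zero] at e₁ e₂
  linarith

/-- **The total kinetic weight is antitone in `U ≥ 0`** (`@[conjecture] def`, PROVED by
`kineticWeightAntitoneU_holds`): `L ≥ 3`, `0 ≤ U₁ < U₂`, unit ground states `ψ₁`, `ψ₂` of the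
`t–t'` torus at `U₁`, `U₂` in one `(N, S^z)` sector ⇒ `𝒦(ψ₂) ≤ 𝒦(ψ₁)`. -/
@[conjecture] def KineticWeightAntitoneU : Prop :=
  ∀ (L : ℕ) [NeZero L], 3 ≤ L → ∀ (t' U₁ U₂ : ℝ), 0 ≤ U₁ → U₁ < U₂ → ∀ (N : ℕ) (M : ℝ)
    (ψ₁ ψ₂ : Fock (Orb (FermionTorus 2 L))),
    IsGroundStateInSector (hubbardTorusTT' L 1 t' U₁) N M ψ₁ → star ψ₁ ⬝ᵥ ψ₁ = 1 →
    IsGroundStateInSector (hubbardTorusTT' L 1 t' U₂) N M ψ₂ → star ψ₂ ⬝ᵥ ψ₂ = 1 →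
    kinWeightTT' t' ψ₂ ≤ kinWeightTT' t' ψ₁

/-- **`KineticWeightAntitoneU` holds.** -/
theorem kineticWeightAntitoneU_holds : KineticWeightAntitoneU :=
  fun _ _ hL t' _ _ hU₁ hU _ _ _ _ hgs₁ h1₁ hgs₂ h1₂ =>
    kinWeightTT'_le_of_nonneg hL t' hU₁ hU hgs₁ h1₁ hgs₂ h1₂

/-- **The free Fermi sea maximises the total kinetic weight over the `U`-axis** (`@[conjecture] def`,
PROVED by `kineticWeightMaximalAtZeroU_holds`): `L ≥ 3`, every `t'`, `U`, every unit ground state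
`ψ` of `H(U)` and `ψ₀` of `H(0)` in one `(N, S^z)` sector ⇒ `𝒦(ψ) ≤ 𝒦(ψ₀)`. -/
@[conjecture] def KineticWeightMaximalAtZeroU : Prop :=
  ∀ (L : ℕ) [NeZero L], 3 ≤ L → ∀ (t' U : ℝ) (N : ℕ) (M : ℝ)
    (ψ ψ₀ : Fock (Orb (FermionTorus 2 L))),
    IsGroundStateInSector (hubbardTorusTT' L 1 t' U) N M ψ → star ψ ⬝ᵥ ψ = 1 →
    IsGroundStateInSector (hubbardTorusTT' L 1 t' 0) N M ψ₀ → star ψ₀ ⬝ᵥ ψ₀ = 1 →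
    kinWeightTT' t' ψ ≤ kinWeightTT' t' ψ₀

/-- **`KineticWeightMaximalAtZeroU` holds** (cases `U > 0`, `U < 0`, `U = 0`). -/
theorem kineticWeightMaximalAtZeroU_holds : KineticWeightMaximalAtZeroU := by
  intro L _ hL t' U N M ψ ψ₀ hgs h1 hgs₀ h1₀
  rcases lt_trichotomy 0 U with hU | hU | hU
  · exact kinWeightTT'_le_of_nonneg hL t' le_rfl hU hgs₀ h1₀ hgs h1
  · subst hU
    exact (kinWeightTT'_eq_of_zero hL t' hgs h1 hgs₀ h1₀).le
  · exact kinWeightTT'_le_of_nonpos hL t' le_rfl hU hgs h1 hgs₀ h1₀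

end Summit.HubbardSuperconductivity.HubbardLadder.Bounds
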